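import Summits.BirchSwinnertonDyer.BirchSwinnertonDyer.Theorems.ManinLocalTwoThreeKummerCubeSigmaMonodromyPrelims
import Summits.BirchSwinnertonDyer.BirchSwinnertonDyer.Theorems.ManinLocalTwoThreeKummerCubeSigmaLeaves
import Summits.BirchSwinnertonDyer.BirchSwinnertonDyer.Theorems.ManinLocalTwoThreeShimuraKernelRealStructure
import HarnessLib

/-!
# The Kummer character IS the monodromy of the `σ`-cube root: `W_u(w + μ) = W_u(w) ∀w ⟺ μ ∈ ℤ·3u + 3Λ` (Weil-pairing dictionary)
# (route `ManinLocalTwoThree`, crux C3 `ManinPrimeToThreeAtNine` stmt-BirchSwinnertonDyer-22968; cell bsd-f2-manin, prover seat p3 gen 15 —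
# toward node (AN♮) of -an g37's UDC line, MEMO-an §80.12: both directions of «`γ ∈ Γ_T` ⟺ the cube root `h` has no monodromy along `γ`»)

-an's `UDCKummerLine.KummerPeriodTrivial D u γ` (`c·{∞,γ∞}_f ∈ ℤ·3u + 3Λ_E`) is the LATTICE form of «`γ` acts trivially on the
`σ`-cube root `W_u(w) = e^{ew/3}σ(w − u)/σ(w)` of the tangent-line function» (`e = m₁η₁ + m₂η₂` for `3u = m₁ω₁ + m₂ω₂`).  The
analytic node (AN♮) needs BOTH directions of this dictionary — `KummerPeriodTrivial ⟹ periodic` to see that `F = D′ρ⁻¹h·P(j)^eΔ^k`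
is automorphic for `Γ_T`, and `periodic ⟹ KummerPeriodTrivial` to read the Unbounded-Denominators conclusion («`h` is `Γ(M)`-invariant»)
as `χ_T = 0 on Γ₀(N) ∩ Γ(M)`.  This file proves it from `σ`'s quasi-periodicity (p2's `sigmaCubeRoot_add_ω₁/ω₂`) and Legendre:

* `sigmaCubeRoot_add_zsmul_add_zsmul` — `W(w + n₁ω₁ + n₂ω₂) = exp((n₁(eω₁ − 3uη₁) + n₂(eω₂ − 3uη₂))/3)·W(w)` (all `w`, all `e`);
* `kummerExponent_eq` — for `3u = m₁ω₁ + m₂ω₂`, `e = m₁η₁ + m₂η₂`: that exponent is `(n₁m₂ − n₂m₁)(η₂ω₁ − η₁ω₂)/3`, a multiple of `2πi/3`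
  by Legendre, i.e. the multiplier is the WEIL PAIRING `e₃(u, μ/3)`;
* **`sigmaCubeRoot_periodic_iff`** — for `u ∉ Λ`, `μ ∈ Λ`: `(∀ w, W(w + μ) = W(w)) ⟺ ∃ k ν, ν ∈ Λ ∧ μ = k·(3u) + 3ν`
  (`𝔽₃`-determinant ⟺ proportionality; `W(−u) ≠ 0`).

HONEST FRAMING.  Pure function theory of `σ`; nothing about (AN♮), C3, Manin's conjecture or BSD is proved.  No definitions, no sorry.
[cite: WhittakerWatson1927, §20.421 (σ quasi-periodicity), §20.411 (Legendre's relation)] [cite: SilvermanAEC2009, III.8 (Weil pairing via σ; shape)]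
-/

set_option autoImplicit false
-- lint-debt: the directory name repeats the summit name (sibling precedent `ManinLocalTwoThreeKummerCubeSigmaLeaves.lean`)
set_option linter.dupNamespace false

noncomputable section

open Complex
open scoped PeriodPair
open Literature.NumberTheory.EllipticCurves
open Summit.BirchSwinnertonDyer.Rank1Residual.ManinAdditive.KummerCubeMonodromy
open Summit.BirchSwinnertonDyer.BirchSwinnertonDyer.Theorems.ManinLocalTwoThree.KummerCubeSigmaLeaves

namespace Summit.BirchSwinnertonDyer.BirchSwinnertonDyer.Theorems.ManinLocalTwoThree.KummerCover

/-! ## §1 The multiplier of `W_{u,e}` under a general lattice vector -/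

/-- **Quasi-periodicity of the `σ`-cube root under `n₁ω₁ + n₂ω₂`** (any integers, any `e`, all `w` — junk values included):
`W(w + n₁ω₁ + n₂ω₂) = exp((n₁(eω₁ − 3uη₁) + n₂(eω₂ − 3uη₂))/3)·W(w)`. [cite: WhittakerWatson1927, §20.421] -/
theorem sigmaCubeRoot_add_zsmul_add_zsmul (L : PeriodPair) (u e : ℂ) (n₁ n₂ : ℤ) (w : ℂ) :
    sigmaCubeRoot L u e (w + ((n₁ : ℂ) * L.ω₁ + (n₂ : ℂ) * L.ω₂)) =
      cexp (((n₁ : ℂ) * (e * L.ω₁ - 3 * u * L.η₁) + (n₂ : ℂ) * (e * L.ω₂ - 3 * u * L.η₂)) / 3) * sigmaCubeRoot L u e w := by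
  -- natural multiples first, then all integers by inverting the multiplier
  have natStep : ∀ {ω c : ℂ}, (∀ w : ℂ, sigmaCubeRoot L u e (w + ω) = cexp (c / 3) * sigmaCubeRoot L u e w) →
      ∀ (n : ℕ) (w : ℂ), sigmaCubeRoot L u e (w + (n : ℂ) * ω) = cexp ((n : ℂ) * c / 3) * sigmaCubeRoot L u e w := by
    intro ω c hω n
    induction n with
    | zero => intro w; simp
    | succ k ih =>
      intro w
      rw [show w + ((k + 1 : ℕ) : ℂ) * ω = (w + (k : ℂ) * ω) + ω by push_cast; ring, hω, ih, ← mul_assoc, ← Complex.exp_add]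
      congr 2; push_cast; ring
  have intStep : ∀ {ω c : ℂ}, (∀ w : ℂ, sigmaCubeRoot L u e (w + ω) = cexp (c / 3) * sigmaCubeRoot L u e w) →
      ∀ (n : ℤ) (w : ℂ), sigmaCubeRoot L u e (w + (n : ℂ) * ω) = cexp ((n : ℂ) * c / 3) * sigmaCubeRoot L u e w := by
    intro ω c hω n w
    obtain ⟨k, rfl | rfl⟩ := Int.eq_nat_or_neg n
    · have h := natStep hω k w
      push_cast at h ⊢
      exact h
    · have h := natStep hω k (w + ((-(k : ℤ) : ℤ) : ℂ) * ω)
      rw [show w + ((-(k : ℤ) : ℤ) : ℂ) * ω + (k : ℂ) * ω = w by push_cast; ring] at h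
      have hE : cexp ((k : ℂ) * c / 3) ≠ 0 := Complex.exp_ne_zero _
      have h' : sigmaCubeRoot L u e (w + ((-(k : ℤ) : ℤ) : ℂ) * ω) = (cexp ((k : ℂ) * c / 3))⁻¹ * sigmaCubeRoot L u e w := by
        rw [eq_inv_mul_iff_mul_eq₀ hE]; exact h.symm
      rw [h', ← Complex.exp_neg]
      congr 2; push_cast; ring
  have step₁ : ∀ (n : ℤ) (w : ℂ), sigmaCubeRoot L u e (w + (n : ℂ) * L.ω₁) =
      cexp ((n : ℂ) * (e * L.ω₁ - 3 * u * L.η₁) / 3) * sigmaCubeRoot L u e w :=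
    intStep (fun w ↦ sigmaCubeRoot_add_ω₁ L u e w)
  have step₂ : ∀ (n : ℤ) (w : ℂ), sigmaCubeRoot L u e (w + (n : ℂ) * L.ω₂) =
      cexp ((n : ℂ) * (e * L.ω₂ - 3 * u * L.η₂) / 3) * sigmaCubeRoot L u e w :=
    intStep (fun w ↦ sigmaCubeRoot_add_ω₂ L u e w)
  rw [show w + ((n₁ : ℂ) * L.ω₁ + (n₂ : ℂ) * L.ω₂) = (w + (n₁ : ℂ) * L.ω₁) + (n₂ : ℂ) * L.ω₂ by ring, step₂, step₁,
    ← mul_assoc, ← Complex.exp_add]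
  congr 2; ring

/-- **The exponent is the Weil pairing**: for `3u = m₁ω₁ + m₂ω₂` and `e = m₁η₁ + m₂η₂`,
`n₁(eω₁ − 3uη₁) + n₂(eω₂ − 3uη₂) = (n₁m₂ − n₂m₁)·(η₂ω₁ − η₁ω₂)`. [cite: WhittakerWatson1927, §20.411] -/
theorem kummerExponent_eq (L : PeriodPair) {u : ℂ} {m₁ m₂ : ℤ} (h3u : (m₁ : ℂ) * L.ω₁ + (m₂ : ℂ) * L.ω₂ = 3 * u) (n₁ n₂ : ℤ) :
    (n₁ : ℂ) * ((m₁ * L.η₁ + m₂ * L.η₂) * L.ω₁ - 3 * u * L.η₁) + (n₂ : ℂ) * ((m₁ * L.η₁ + m₂ * L.η₂) * L.ω₂ - 3 * u * L.η₂) =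
      ((n₁ : ℂ) * m₂ - n₂ * m₁) * (L.η₂ * L.ω₁ - L.η₁ * L.ω₂) := by
  rw [← h3u]; ring

/-- In `𝔽₃²`, a vector with vanishing determinant against a nonzero vector is a multiple of it (local copy of the LEAD's private lemma). -/
private theorem zmod3_exists_smul_of_det_eq_zero' :
    ∀ a b m n : ZMod 3, (a ≠ 0 ∨ b ≠ 0) → m * b - n * a = 0 → ∃ k : ZMod 3, m = k * a ∧ n = k * b := by
  decide

/-! ## §2 The dictionary -/

/-- **`W_u` is `μ`-periodic iff `μ ∈ ℤ·3u + 3Λ`** (the Kummer character of the cube root is the Weil pairing `e₃(u, μ/3)`): for `u ∉ Λ`,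
`3u = m₁ω₁ + m₂ω₂`, `e = m₁η₁ + m₂η₂` and `μ ∈ Λ`,
`(∀ w, W_{u,e}(w + μ) = W_{u,e}(w)) ⟺ ∃ k ν, ν ∈ Λ ∧ μ = k·(3u) + 3ν` — i.e. `γ ∈ Γ_T ⟺ KummerPeriodTrivial` for `μ = c·{∞,γ∞}_f`.
Proof: the multiplier is `exp((n₁m₂ − n₂m₁)(η₂ω₁ − η₁ω₂)/3)` with `η₁ω₂ − η₂ω₁ = ±2πi` (Legendre); it is `1` iff `3 ∣ n₁m₂ − n₂m₁`
(`W(−u) ≠ 0`, `three_dvd_of_cexp_eq_one`), iff `(n₁, n₂) ≡ k(m₁, m₂) (mod 3)` (`(m₁, m₂) ≢ 0` as `u ∉ Λ`).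
[cite: WhittakerWatson1927, §20.421 and §20.411] [cite: SilvermanAEC2009, III.8 (Weil pairing; shape)] -/
theorem sigmaCubeRoot_periodic_iff (L : PeriodPair) {u : ℂ} (hu : u ∉ L.lattice) {m₁ m₂ : ℤ}
    (h3u : (m₁ : ℂ) * L.ω₁ + (m₂ : ℂ) * L.ω₂ = 3 * u) {μ : ℂ} (hμ : μ ∈ L.lattice) :
    (∀ w : ℂ, sigmaCubeRoot L u (m₁ * L.η₁ + m₂ * L.η₂) (w + μ) = sigmaCubeRoot L u (m₁ * L.η₁ + m₂ * L.η₂) w) ↔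
      ∃ k : ℤ, ∃ ν ∈ L.lattice, μ = k * (3 * u) + 3 * ν := by
  set e : ℂ := m₁ * L.η₁ + m₂ * L.η₂ with he
  obtain ⟨n₁, n₂, rfl⟩ := PeriodPair.mem_lattice.mp hμ
  -- Legendre: `η₁ω₂ − η₂ω₁ = s·2πi`
  obtain ⟨s, hs, hδ⟩ : ∃ s : ℤ, (s = 1 ∨ s = -1) ∧ L.η₁ * L.ω₂ - L.η₂ * L.ω₁ = (s : ℂ) * (2 * Real.pi * I) := by
    rcases L.im_ω₂_div_ω₁_pos_or with h | h
    · exact ⟨1, Or.inl rfl, by rw [L.legendre_relation_holds h]; simp⟩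
    · refine ⟨-1, Or.inr rfl, ?_⟩
      have h' := L.legendre_relation_of_neg h
      linear_combination -h'
  -- the multiplier
  have hmult : ∀ w, sigmaCubeRoot L u e (w + ((n₁ : ℂ) * L.ω₁ + (n₂ : ℂ) * L.ω₂)) =
      cexp (((-(n₁ * m₂ - n₂ * m₁) : ℤ) : ℂ) * ((s : ℂ) * (2 * Real.pi * I)) / 3) * sigmaCubeRoot L u e w := by
    intro w
    rw [sigmaCubeRoot_add_zsmul_add_zsmul, he, kummerExponent_eq L h3u]
    congr 2
    push_cast
    linear_combination (-((n₁ : ℂ) * m₂ - n₂ * m₁) / 3) * hδ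
  -- `(m₁, m₂) ≢ 0 (mod 3)` and `2u ∉ Λ`
  have h3uΛ : 3 * u ∈ L.lattice := PeriodPair.mem_lattice.mpr ⟨m₁, m₂, h3u⟩
  have hnd : ¬ ((3 : ℤ) ∣ m₁ ∧ (3 : ℤ) ∣ m₂) := by
    rintro ⟨⟨k₁, hk₁⟩, ⟨k₂, hk₂⟩⟩
    apply hu
    rw [PeriodPair.mem_lattice]
    refine ⟨k₁, k₂, ?_⟩
    have h3 : (3 : ℂ) * u = 3 * (k₁ * L.ω₁ + k₂ * L.ω₂) := by rw [← h3u, hk₁, hk₂]; push_cast; ring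
    exact (mul_left_cancel₀ (by norm_num : (3 : ℂ) ≠ 0) h3).symm
  have h2u : 2 * u ∉ L.lattice := fun h ↦ hu (by
    have := L.lattice.sub_mem h3uΛ h
    rwa [show (3 : ℂ) * u - 2 * u = u by ring] at this)
  have hW0 := sigmaCubeRoot_neg_ne_zero L u e hu h2u
  constructor
  · -- periodic ⟹ `3 ∣ det` ⟹ proportional mod 3
    intro hper
    have h1 : cexp (((-(n₁ * m₂ - n₂ * m₁) : ℤ) : ℂ) * ((s : ℂ) * (2 * Real.pi * I)) / 3) = 1 := by
      have h := hper (-u)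
      rw [hmult] at h
      exact mul_right_cancel₀ hW0 (h.trans (one_mul _).symm)
    have hdvd : (3 : ℤ) ∣ n₁ * m₂ - n₂ * m₁ := (dvd_neg).mp (three_dvd_of_cexp_eq_one hs h1)
    have hm0 : (m₁ : ZMod 3) ≠ 0 ∨ (m₂ : ZMod 3) ≠ 0 := by
      by_contra hcon
      push Not at hcon
      refine hnd ⟨?_, ?_⟩
      · exact_mod_cast (ZMod.intCast_zmod_eq_zero_iff_dvd m₁ 3).mp hcon.1
      · exact_mod_cast (ZMod.intCast_zmod_eq_zero_iff_dvd m₂ 3).mp hcon.2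
    have hdet : (n₁ : ZMod 3) * (m₂ : ZMod 3) - (n₂ : ZMod 3) * (m₁ : ZMod 3) = 0 := by
      have := (ZMod.intCast_zmod_eq_zero_iff_dvd (n₁ * m₂ - n₂ * m₁) 3).mpr (by exact_mod_cast hdvd)
      push_cast at this
      exact this
    obtain ⟨k, hk₁, hk₂⟩ := zmod3_exists_smul_of_det_eq_zero' _ _ _ _ hm0 hdet
    -- lift `k` to `ℤ` and conclude
    have hk : ((k.val : ℕ) : ZMod 3) = k := ZMod.natCast_zmod_val k
    have hd₁ : (3 : ℤ) ∣ n₁ - k.val * m₁ := by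
      have h0 : ((n₁ - (k.val : ℤ) * m₁ : ℤ) : ZMod 3) = 0 := by push_cast; rw [hk, hk₁]; ring
      exact_mod_cast (ZMod.intCast_zmod_eq_zero_iff_dvd _ 3).mp h0
    have hd₂ : (3 : ℤ) ∣ n₂ - k.val * m₂ := by
      have h0 : ((n₂ - (k.val : ℤ) * m₂ : ℤ) : ZMod 3) = 0 := by push_cast; rw [hk, hk₂]; ring
      exact_mod_cast (ZMod.intCast_zmod_eq_zero_iff_dvd _ 3).mp h0
    obtain ⟨y, hy, hy'⟩ := (PeriodPair.exists_eq_three_mul_iff L (n₁ - k.val * m₁) (n₂ - k.val * m₂)).mpr ⟨hd₁, hd₂⟩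
    refine ⟨(k.val : ℤ), y, hy, ?_⟩
    rw [← h3u, ← hy']
    push_cast
    ring
  · -- `μ = k·3u + 3ν` ⟹ `3 ∣ det` ⟹ periodic
    rintro ⟨k, ν, hν, hkν⟩ w
    obtain ⟨ν₁, ν₂, rfl⟩ := PeriodPair.mem_lattice.mp hν
    have hcoord : ((n₁ - (k * m₁ + 3 * ν₁) : ℤ) : ℂ) * L.ω₁ + ((n₂ - (k * m₂ + 3 * ν₂) : ℤ) : ℂ) * L.ω₂ = 0 := by
      push_cast
      have := hkν
      rw [← h3u] at this
      linear_combination this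
    obtain ⟨e₁, e₂⟩ := PeriodPair.intCast_pair_eq_zero L hcoord
    have hn₁ : n₁ = k * m₁ + 3 * ν₁ := by linarith
    have hn₂ : n₂ = k * m₂ + 3 * ν₂ := by linarith
    rw [hmult w]
    have hdet : (-(n₁ * m₂ - n₂ * m₁) : ℤ) = 3 * (ν₂ * m₁ - ν₁ * m₂) := by rw [hn₁, hn₂]; ring
    rw [hdet]
    have : cexp (((3 * (ν₂ * m₁ - ν₁ * m₂) : ℤ) : ℂ) * ((s : ℂ) * (2 * Real.pi * I)) / 3) = 1 := by
      rw [Complex.exp_eq_one_iff]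
      refine ⟨(ν₂ * m₁ - ν₁ * m₂) * s, ?_⟩
      push_cast; ring
    rw [this, one_mul]

end Summit.BirchSwinnertonDyer.BirchSwinnertonDyer.Theorems.ManinLocalTwoThree.KummerCover

end
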